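import Literature.Topology.PlaneTopology.GermRegions
import Literature.Topology.PlaneTopology.CrosscutProofs
import HarnessLib

/-!
# The germ region of a Jordan domain is a Jordan domain

Sub-problem `CriticalPhenomena/SAWScalingLimit`, crux `AvoidanceLimit`
(`Summit.CriticalPhenomena.SAWScalingLimit.Theses.SAWLoopFugacityFlow.AvoidanceLimit`,
stmt-CriticalPhenomena-10649), line `symplectic-fermion-anchor`, stub W1.

Let `D` be a Jordan domain, `Q = boxJD b s` the open box of radius `s` about `b` (as a Jordan
domain), `g ∈ D ∩ box b s` a base point and `o ∈ D` a far point off the closed box. The **germ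
region** `germRegion D b hs g o` (`GermRegions.lean`; the regions `Ω_o(b,r)` of Chelkak–Wan 2021,
§3.2, with boxes for discs) is the side of the germ gate containing `g`, i.e. one of the two
domains into which the gate arc — a cross-cut of `D` — splits `D` (Newman 1939, Ch. V §11,
Thms. 11·7–11·8, `gateSide_gateFar_spec`). Its frontier is the gate arc followed by the arc of
`∂D` between the gate ends; these two simple arcs meet only at their common end-points, so they
glue to a Jordan loop (`IsSimpleArc.exists_periodic_of_union`), and the germ region, being open,
bounded and connected with this loop as frontier, is itself a Jordan domain
(`exists_jordanDomain_germRegion`). More generally every side of a gate is a Jordan domain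
(`exists_loop_gateSide`).

## References
* M. H. A. Newman, *Elements of the topology of plane sets of points*, Cambridge Univ. Press
  (1939), Ch. V §11, Thms. 11·7–11·8. [Newman1939]
* D. Chelkak, Y. Wan, *On the convergence of massive loop-erased random walks to massive SLE(2)
  curves*, Electron. J. Probab. 26 (2021), §3.2. [ChelkakWan2021]
-/

noncomputable section

open Set Metric
open Literature.Topology.PlaneTopology
open Literature.Probability.RandomPlanarGeometry (JordanDomain)

namespace Summit.CriticalPhenomena.SAWScalingLimit.Theorems.AvoidanceLimit.Anchor

/-- **The frontier of a side of a gate is a Jordan loop**: for a gate of `D` on the loop `∂Q`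
(two points of `∂Q` off `D`) through a parameter `t₀` mapped into `D`, and a base point `g ∈ D`
off the gate, the frontier of the side of `g` is the range of a continuous `1`-periodic map
injective on `[0, 1)` — the gate arc followed by the arc of `∂D` between the gate ends, reversed
as needed (Newman 1939, Ch. V §11, Thms. 11·7–11·8: the components of `D − L` have frontiers
`L ∪ L₁`, `L ∪ L₂`, simple closed curves). [cite: Newman1939, Ch. V §11, Thms. 11·7–11·8] -/
theorem exists_loop_gateSide {D Q : JordanDomain} (h2 : TwoOff D Q) {t₀ : ℝ}
    (ht₀ : t₀ ∈ gateParams D Q) {g : ℂ} (hg : g ∈ D.carrier \ gate D Q t₀) :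
    ∃ γ : ℝ → ℂ, Continuous γ ∧ Function.Periodic γ 1 ∧ InjOn γ (Ico 0 1) ∧
      range γ = frontier (gateSide D Q g t₀) := by
  obtain ⟨-, -, -, -, σ, τ, hστ, hτσ, hends, hf, -⟩ := gateSide_gateFar_spec h2 ht₀ hg
  -- the gate arc, a simple arc from the lower gate end to the upper gate end
  have harc : IsSimpleArc (gateArc D Q t₀) (Q.boundary (gateLo D Q t₀))
      (Q.boundary (gateHi D Q t₀)) := isSimpleArc_gateArc h2 ht₀
  -- the arc of `∂D` between the gate ends, a simple arc from `D.boundary σ` to `D.boundary τ`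
  have hbd : IsSimpleArc (D.boundary '' Icc σ τ) (D.boundary σ) (D.boundary τ) :=
    D.isSimpleArc_image_boundary hστ hτσ
  -- oriented from the upper gate end back to the lower gate end
  have hbd' : IsSimpleArc (D.boundary '' Icc σ τ) (Q.boundary (gateHi D Q t₀))
      (Q.boundary (gateLo D Q t₀)) := by
    rcases Set.pair_eq_pair_iff.1 hends with ⟨hσ, hτ⟩ | ⟨hσ, hτ⟩
    · rw [← hσ, ← hτ]; exact hbd.symm
    · rw [← hσ, ← hτ]; exact hbd
  -- the two arcs meet only at the gate ends: other points of the gate arc are in the open `D`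
  have hmeet : gateArc D Q t₀ ∩ D.boundary '' Icc σ τ ⊆
      {Q.boundary (gateLo D Q t₀), Q.boundary (gateHi D Q t₀)} := by
    rintro z ⟨hzA, ⟨θ, -, rfl⟩⟩
    by_contra hz
    have hzg : D.boundary θ ∈ gate D Q t₀ := by
      rw [gate_eq_gateArc_diff h2]; exact ⟨hzA, hz⟩
    exact Set.disjoint_left.1 D.disjoint_carrier_frontier (gate_subset_carrier t₀ hzg)
      (D.boundary_mem_frontier θ)
  obtain ⟨γ, hγ, hp, hinj, hrange⟩ := harc.exists_periodic_of_union hbd' hmeet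
  exact ⟨γ, hγ, hp, hinj, by rw [hrange, hf]⟩

/-- **The germ region is a Jordan domain** (stub W1 of the line `symplectic-fermion-anchor`): for
a Jordan domain `D`, a box `boxJD b hs` whose boundary square has two points off `D`, a base point
`g ∈ D ∩ box b s` and a far point `o ∈ D` off the closed box, there is a Jordan domain whose
carrier is the germ region `germRegion D b hs g o` — open and connected by Newman's cross-cut
theorem for the germ gate, bounded as a subset of `D`, with boundary loop the gate arc followed by
the arc of `∂D` between the gate ends (`exists_loop_gateSide`). [cite: Newman1939, Ch. V §11, Thms. 11·7–11·8] -/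
theorem exists_jordanDomain_germRegion :
    ∀ (D : JordanDomain) (b : ℂ) (s : ℝ) (hs : 0 < s) (g o : ℂ),
      TwoOff D (boxJD b hs) → g ∈ D.carrier ∩ Literature.Topology.PlaneTopology.box b s →
      o ∈ D.carrier → o ∉ closedBox b s →
      ∃ J : JordanDomain, J.carrier = germRegion D b hs g o := by
  intro D b s hs g o h2 hg ho hoc
  obtain ⟨ht₀, -, -⟩ := germGateParam_spec h2 hg ho hoc
  have hg' : g ∈ D.carrier \ gate D (boxJD b hs) (germGateParam D b hs g o) :=
    base_not_mem_gate hs hg _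
  obtain ⟨hopen, -, hconn, -, -⟩ := gateSide_gateFar_spec h2 ht₀ hg'
  obtain ⟨γ, hγ, hp, hinj, hrange⟩ := exists_loop_gateSide h2 ht₀ hg'
  exact ⟨{ carrier := gateSide D (boxJD b hs) g (germGateParam D b hs g o)
           boundary := γ
           isOpen := hopen
           isBounded := D.isBounded.subset fun z hz => (gateSide_subset g _ hz).1
           isConnected := hconn
           continuous_boundary := hγ
           periodic_boundary := hp
           injOn_boundary := hinj
           range_boundary := hrange }, rfl⟩

end Summit.CriticalPhenomena.SAWScalingLimit.Theorems.AvoidanceLimit.Anchor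

end
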